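import Mathlib

/-!
# Solo-blind kernel #281 — a Gershgorin certificate for the numerical abscissa

Kernels #274/#275 turn a bound `Re⟪A w, w⟫ ≤ μ‖w‖²` (numerical abscissa `≤ μ`) into the exponential
order `‖e^{tA}‖ ≤ K e^{μt}` of the read-out kernel.  Here `μ` is made CERTIFIABLE FROM MATRIX ENTRIES:
for `M : Matrix n n ℂ`,
  `Re Σ_i v_i conj((Mv)_i) ≤ μ Σ_i |v_i|²` whenever `Re M_ii + ½ Σ_{j≠i} (|M_ij| + |M_ji|) ≤ μ` for all `i`
(AM–GM on the off-diagonal terms = Gershgorin's bound for the Hermitian part), and the bridge to the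
Hilbert-space form of #274 for `A = Matrix.toEuclideanCLM M` on `EuclideanSpace ℂ n`.
ENGINE-L-SPEC §16(q)(iv).
-/

namespace Summit.AnomalousDissipation.SoloBlind.GershgorinAbscissa

open Matrix Complex
open scoped ComplexConjugate

variable {n : Type*} [Fintype n] [DecidableEq n]

/-- Off-diagonal absolute row sum `Σ_{j ≠ i} |M_ij|`. -/
noncomputable def offRow (M : Matrix n n ℂ) (i : n) : ℝ := ∑ j, if j = i then 0 else ‖M i j‖

/-- Off-diagonal absolute column sum `Σ_{j ≠ i} |M_ji|`. -/
noncomputable def offCol (M : Matrix n n ℂ) (i : n) : ℝ := ∑ j, if j = i then 0 else ‖M j i‖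

omit [DecidableEq n] in
/-- Expansion of the quadratic form `v ⬝ᵥ conj(Mv)` as a double sum. -/
theorem dotProduct_star_mulVec (M : Matrix n n ℂ) (v : n → ℂ) :
    v ⬝ᵥ star (M *ᵥ v) = ∑ i, ∑ j, v i * conj (M i j * v j) := by
  simp only [dotProduct, Matrix.mulVec, Pi.star_apply]
  refine Finset.sum_congr rfl fun i _ => ?_
  rw [show star (∑ j, M i j * v j) = conj (∑ j, M i j * v j) from rfl, map_sum, Finset.mul_sum]

/-- Diagonal term: `Re (v_i conj(M_ii v_i)) = Re(M_ii) |v_i|²`. -/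
theorem re_diag_term (c z : ℂ) : (z * conj (c * z)).re = c.re * ‖z‖ ^ 2 := by
  have h : z * conj (c * z) = conj c * (z * conj z) := by rw [map_mul]; ring
  rw [h, Complex.mul_conj, Complex.re_mul_ofReal, Complex.conj_re, Complex.normSq_eq_norm_sq]

/-- Off-diagonal term: `Re (v_i conj(M_ij v_j)) ≤ |M_ij| (|v_i|² + |v_j|²)/2`. -/
theorem re_off_term (c z w : ℂ) :
    (z * conj (c * w)).re ≤ ‖c‖ * ‖z‖ ^ 2 / 2 + ‖c‖ * ‖w‖ ^ 2 / 2 := by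
  have h1 : (z * conj (c * w)).re ≤ ‖z * conj (c * w)‖ := Complex.re_le_norm _
  have h2 : ‖z * conj (c * w)‖ = ‖z‖ * (‖c‖ * ‖w‖) := by
    rw [norm_mul, Complex.norm_conj, norm_mul]
  rw [h2] at h1
  nlinarith [sq_nonneg (‖z‖ - ‖w‖), norm_nonneg c, norm_nonneg z, norm_nonneg w,
    mul_nonneg (norm_nonneg c) (sq_nonneg (‖z‖ - ‖w‖))]

/-- **Gershgorin bound for the real part of the quadratic form** (coordinates). -/
theorem re_dotProduct_le (M : Matrix n n ℂ) {μ : ℝ}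
    (hμ : ∀ i, (M i i).re + (offRow M i + offCol M i) / 2 ≤ μ) (v : n → ℂ) :
    (v ⬝ᵥ star (M *ᵥ v)).re ≤ μ * ∑ i, ‖v i‖ ^ 2 := by
  -- per-term majorant
  set N : n → n → ℝ := fun i j => if j = i then 0 else ‖M i j‖ with hN
  set a : n → ℝ := fun i => ‖v i‖ ^ 2 with ha
  set E : n → n → ℝ := fun i j =>
    (if j = i then (M i i).re * a i else 0) + N i j * a i / 2 + N i j * a j / 2 with hE
  have hterm : ∀ i j, (v i * conj (M i j * v j)).re ≤ E i j := by
    intro i j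
    by_cases hij : j = i
    · subst hij
      simp only [hE, hN, ha, if_true, zero_mul, zero_div, add_zero]
      exact (re_diag_term (M j j) (v j)).le
    · simp only [hE, hN, ha, hij, if_false, zero_add]
      exact re_off_term (M i j) (v i) (v j)
  have hsumE : ∑ i, ∑ j, E i j = ∑ i, a i * ((M i i).re + (offRow M i + offCol M i) / 2) := by
    have h4a : ∑ i, ∑ j, (if j = i then (M i i).re * a i else 0) = ∑ i, (M i i).re * a i := by
      refine Finset.sum_congr rfl fun i _ => ?_
      rw [Finset.sum_ite_eq' Finset.univ i]; simp
    have h4b : ∑ i, ∑ j, N i j * a i / 2 = ∑ i, a i / 2 * offRow M i := by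
      refine Finset.sum_congr rfl fun i _ => ?_
      rw [offRow, Finset.mul_sum]
      exact Finset.sum_congr rfl fun j _ => by simp only [hN]; ring
    have h4c : ∑ i, ∑ j, N i j * a j / 2 = ∑ j, a j / 2 * offCol M j := by
      rw [Finset.sum_comm]
      refine Finset.sum_congr rfl fun j _ => ?_
      rw [offCol, Finset.mul_sum]
      exact Finset.sum_congr rfl fun i _ => by
        rcases eq_or_ne i j with h | h
        · subst h; simp [hN]
        · simp only [hN, h, h.symm, if_false]; ring
    have hsplit : ∑ i, ∑ j, E i j = (∑ i, ∑ j, (if j = i then (M i i).re * a i else 0))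
        + (∑ i, ∑ j, N i j * a i / 2) + ∑ i, ∑ j, N i j * a j / 2 := by
      simp only [hE, Finset.sum_add_distrib]
    rw [hsplit, h4a, h4b, h4c, ← Finset.sum_add_distrib, ← Finset.sum_add_distrib]
    exact Finset.sum_congr rfl fun i _ => by ring
  rw [dotProduct_star_mulVec, Complex.re_sum]
  simp_rw [Complex.re_sum]
  calc ∑ i, ∑ j, (v i * conj (M i j * v j)).re
      ≤ ∑ i, ∑ j, E i j := Finset.sum_le_sum fun i _ => Finset.sum_le_sum fun j _ => hterm i j
    _ = ∑ i, a i * ((M i i).re + (offRow M i + offCol M i) / 2) := hsumE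
    _ ≤ ∑ i, a i * μ := Finset.sum_le_sum fun i _ =>
        mul_le_mul_of_nonneg_left (hμ i) (by simp only [ha]; positivity)
    _ = μ * ∑ i, ‖v i‖ ^ 2 := by rw [← Finset.sum_mul, mul_comm]

/-- **Bridge to the Hilbert-space form of #274**: for `A = toEuclideanCLM M` on `EuclideanSpace ℂ n`,
the Gershgorin row/column condition gives `Re⟪A w, w⟫ ≤ μ‖w‖²` for every `w`. -/
theorem re_inner_toEuclideanCLM_le (M : Matrix n n ℂ) {μ : ℝ}
    (hμ : ∀ i, (M i i).re + (offRow M i + offCol M i) / 2 ≤ μ) (w : EuclideanSpace ℂ n) :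
    (@inner ℂ _ _ (Matrix.toEuclideanCLM (n := n) (𝕜 := ℂ) M w) w).re ≤ μ * ‖w‖ ^ 2 := by
  rw [EuclideanSpace.inner_eq_star_dotProduct, Matrix.ofLp_toEuclideanCLM, EuclideanSpace.norm_sq_eq]
  exact re_dotProduct_le M hμ (WithLp.ofLp w)

end Summit.AnomalousDissipation.SoloBlind.GershgorinAbscissa
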